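import Mathlib.Algebra.Lie.Prod
import Literature.NumberTheory.Automorphic.RootStrings
import Literature.NumberTheory.Automorphic.TorusLieDual
import Literature.NumberTheory.Automorphic.TorusIsoOfCharacters
import HarnessLib

/-!
# The Lie-algebra isomorphism theorem, I: the graph subalgebra of two reductive groups with one root datum
(trunk T-AUTOMORPHIC, G25 AutomorphicL; Humphreys, *Introduction to Lie Algebras*, Thm. 14.2; DAG of
`Literature.NumberTheory.Automorphic.chevalley_isomorphism`, step 1 of Springer 9.6.2)

Let `(G₁, T₁)` in `GL n₁` and `(G₂, T₂)` in `GL n₂` be connected reductive groups with maximal tori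
over an algebraically closed field of characteristic `0`, both with the root datum `P`
(`IsRootDatumOf Gⱼ Tⱼ P eXⱼ eYⱼ`). Following Humphreys' proof of the isomorphism theorem for
semisimple Lie algebras (14.2) we work in the product Lie algebra
`𝕃 = 𝔤𝔩_{n₁} × 𝔤𝔩_{n₂}` (commutator bracket, Mathlib's product Lie algebra) and set up:

* `PW x` — the product `𝔤₁_x × 𝔤₂_x` of the weight spaces of a weight `x ∈ X`;
  `lie_mem_PW` (`[PW x, PW y] ⊆ PW (x + y)`);
* `theta` — **the canonical identification `θ : Lie(T₁) ≅ Lie(T₂)`** through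
  `Lie(Tⱼ) ≅ Hom(X*(Tⱼ), k)` (`TorusLieDual.lean`) and `X*(T₁) ≅ X ≅ X*(T₂)`; `dChar_theta`
  (`dχ²_x (θ H) = dχ¹_x (H)`), `theta_rootH` (`θ (h¹_i) = h²_i`, by `dχ_x (hⱼ_i) = ⟨x, α_i^∨⟩`);
* `torusIso` — the isomorphism of tori `f : T₁ ≅ T₂` with `χ²_x ∘ f = χ¹_x`
  (`torusIsoOfWeights`, `TorusIsoOfCharacters.lean`) and the Lie automorphisms `sigma t = (Ad t, Ad (f t))` of `𝕃`, acting on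
  `PW x` by the scalar `χ¹_x (t)` (`sigma_apply_of_mem_PW`);
* `genSet`, **`graphSubalgebra`** — the Lie subalgebra `D` of `𝕃` generated by
  `(e¹_i, e²_i)`, `(f¹_i, f²_i)` for the simple roots `α_i` (w.r.t. a regular coweight `y`) and
  the graph `{(H, θ H)}` of `θ` (Humphreys' `D`, with the whole Cartan graph instead of the
  `(h_α, h'_α)`); proved: `graphSubalgebra_le_prod` (`D ⊆ 𝔤₁ × 𝔤₂`), `sigma_mem_graphSubalgebra`
  (`D` is `σ_t`-stable), `lie_graph_of_mem_PW` (`[(H, θH), A] = dχ¹_x(H) A` on `PW x`),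
  `rootH_pair_mem` (`(h¹_i, h²_i) ∈ D`), and the projections: `exists_mem_fst_eq_rootE/F`,
  `exists_mem_snd_eq_rootE/F` (`pⱼ(D)` contains all root vectors, by the generation theorem of
  `RootStrings.lean`), `exists_mem_snd_eq_of_mem_lieAlgebraGL` (`p₂(D) ⊇ Lie(T₂)`).

The sequel files prove that `D` is the graph of an isomorphism `𝔤₁ ≅ 𝔤₂`.

## Mathlib

`LieAlgebra.Prod` (product Lie algebra, `LieHom.fst/snd`), `LieSubalgebra.lieSpan`,
`LieSubalgebra.map/comap`, `Submodule.prod`, `LinearEquiv.ofBijective`, with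
`LieRing.ofAssociativeRing` as a local instance on matrices. Nothing here duplicates a Mathlib or
Literature declaration (searched `graphSubalgebra`, `theta` + `lieAlgebraGL`, `lieSpan` in
Literature).

## References

* [Humphreys1972] J. E. Humphreys, *Introduction to Lie Algebras and Representation Theory*,
  GTM 9, Springer (1972), §14.2 (Theorem and its proof), §18.4.
* [SpringerLAG1998] T. A. Springer, *Linear Algebraic Groups*, 2nd ed. (1998), 9.6.2.
-/

noncomputable section

open scoped MatrixGroups IsMulCommutative
open Set

attribute [local instance 100] LieRing.ofAssociativeRing

namespace Literature.NumberTheory.Automorphic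

namespace LieGraph

variable {k : Type*} [Field k]
variable {n₁ n₂ : Type*} [Fintype n₁] [DecidableEq n₁] [Fintype n₂] [DecidableEq n₂]
variable {ι X Y : Type*} [AddCommGroup X] [AddCommGroup Y]
variable {G₁ T₁ : Subgroup (GL n₁ k)} {G₂ T₂ : Subgroup (GL n₂ k)}
  [IsMulCommutative ↥T₁] [IsMulCommutative ↥T₂]
variable {P : RootPairing ι ℤ X Y}
variable {eX₁ : Additive ↥(characterLattice T₁) ≃+ X} {eY₁ : Additive ↥(cocharacterLattice T₁) ≃+ Y}
variable {eX₂ : Additive ↥(characterLattice T₂) ≃+ X} {eY₂ : Additive ↥(cocharacterLattice T₂) ≃+ Y}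

/-! ### The product Lie algebra and the product weight spaces -/

omit [IsMulCommutative ↥T₁] [IsMulCommutative ↥T₂] in
/-- The bracket of `𝕃 = 𝔤𝔩_{n₁} × 𝔤𝔩_{n₂}` is the pair of commutators. [folklore] -/
lemma bracket_eq (A B : Matrix n₁ n₁ k × Matrix n₂ n₂ k) :
    ⁅A, B⁆ = (A.1 * B.1 - B.1 * A.1, A.2 * B.2 - B.2 * A.2) := by
  rw [LieAlgebra.Prod.bracket_apply, Ring.lie_def, Ring.lie_def]

variable (G₁ G₂ eX₁ eX₂) in
/-- The product weight space `PW x = 𝔤₁_x × 𝔤₂_x` of the weight `x ∈ X`. [folklore] -/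
def PW (x : X) : Submodule k (Matrix n₁ n₁ k × Matrix n₂ n₂ k) :=
  (lieWeightSpace G₁ T₁ (charOfWeight eX₁ x)).prod (lieWeightSpace G₂ T₂ (charOfWeight eX₂ x))

omit [IsMulCommutative ↥T₁] [IsMulCommutative ↥T₂] in
/-- Membership in `PW x`. [folklore] -/
lemma mem_PW_iff {x : X} {A : Matrix n₁ n₁ k × Matrix n₂ n₂ k} :
    A ∈ PW G₁ G₂ eX₁ eX₂ x ↔ A.1 ∈ lieWeightSpace G₁ T₁ (charOfWeight eX₁ x) ∧
      A.2 ∈ lieWeightSpace G₂ T₂ (charOfWeight eX₂ x) :=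
  Submodule.mem_prod

omit [IsMulCommutative ↥T₁] [IsMulCommutative ↥T₂] in
/-- **`[PW x, PW y] ⊆ PW (x + y)`.** [cite: SpringerLAG1998, 7.1.1] -/
theorem lie_mem_PW {x y : X} {A B : Matrix n₁ n₁ k × Matrix n₂ n₂ k}
    (hA : A ∈ PW G₁ G₂ eX₁ eX₂ x) (hB : B ∈ PW G₁ G₂ eX₁ eX₂ y) :
    ⁅A, B⁆ ∈ PW G₁ G₂ eX₁ eX₂ (x + y) := by
  rw [mem_PW_iff] at hA hB ⊢
  rw [bracket_eq]
  exact ⟨lie_mem_lieWeightSpace_charOfWeight eX₁ hA.1 hB.1,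
    lie_mem_lieWeightSpace_charOfWeight eX₂ hA.2 hB.2⟩

/-- `Lie(T₁) × Lie(T₂) ⊆ PW 0`. [folklore] -/
theorem mem_PW_zero_of_mem_lieAlgebraGL
    (h₁le : T₁ ≤ G₁) (h₂le : T₂ ≤ G₂) {H₁ : Matrix n₁ n₁ k} {H₂ : Matrix n₂ n₂ k}
    (hH₁ : H₁ ∈ lieAlgebraGL T₁) (hH₂ : H₂ ∈ lieAlgebraGL T₂) : (H₁, H₂) ∈ PW G₁ G₂ eX₁ eX₂ 0 := by
  rw [mem_PW_iff, lieWeightSpace_charOfWeight_zero_eq, lieWeightSpace_charOfWeight_zero_eq]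
  exact ⟨lieAlgebraGL_le_lieWeightSpace_one h₁le hH₁, lieAlgebraGL_le_lieWeightSpace_one h₂le hH₂⟩

/-! ### The canonical identification `θ : Lie(T₁) ≅ Lie(T₂)` -/

section Theta

/-- Pre-composition with an additive isomorphism, as a `k`-linear isomorphism of `Hom(·, k)`.
[folklore] -/
def precompLinearEquiv {A B : Type*} [AddCommGroup A] [AddCommGroup B] (ε : A ≃+ B) :
    (B →+ k) ≃ₗ[k] (A →+ k) where
  toFun ℓ := ℓ.comp ε.toAddMonoidHom
  invFun ℓ := ℓ.comp ε.symm.toAddMonoidHom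
  map_add' ℓ ℓ' := by ext a; rfl
  map_smul' c ℓ := by ext a; rfl
  left_inv ℓ := AddMonoidHom.ext fun b => by simp
  right_inv ℓ := AddMonoidHom.ext fun a => by simp

variable (eX₁ eX₂) in
/-- **The identification `θ : Lie(T₁) ≅ Lie(T₂)`** of the Lie algebras of two tori whose
character lattices are identified with one lattice `X`:
`Lie(T₁) ≅ Hom(X*(T₁), k) ≅ Hom(X, k) ≅ Hom(X*(T₂), k) ≅ Lie(T₂)` (`lieTorusDual_bijective`).
[cite: SpringerLAG1998, 4.4.13] -/
def theta [IsAlgClosed k] (hT₁ : IsTorusSubgroup T₁) (hT₂ : IsTorusSubgroup T₂) :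
    ↥(lieAlgebraGL T₁) ≃ₗ[k] ↥(lieAlgebraGL T₂) :=
  (LinearEquiv.ofBijective (lieTorusDual T₁) (lieTorusDual_bijective hT₁)).trans
    ((precompLinearEquiv (eX₂.trans eX₁.symm)).trans
      (LinearEquiv.ofBijective (lieTorusDual T₂) (lieTorusDual_bijective hT₂)).symm)

variable [IsAlgClosed k] (hT₁ : IsTorusSubgroup T₁) (hT₂ : IsTorusSubgroup T₂)

variable (eX₁ eX₂) in
omit [IsMulCommutative ↥T₁] [IsMulCommutative ↥T₂] in
/-- The image of `θ H` under the duality map of `T₂` is the transport of that of `H`. [folklore] -/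
lemma lieTorusDual_theta (H : ↥(lieAlgebraGL T₁)) :
    lieTorusDual T₂ (theta eX₁ eX₂ hT₁ hT₂ H) =
      precompLinearEquiv (eX₂.trans eX₁.symm) (lieTorusDual T₁ H) :=
  LinearEquiv.apply_symm_apply (LinearEquiv.ofBijective (lieTorusDual T₂) (lieTorusDual_bijective hT₂)) _

variable (eX₁ eX₂) in
omit [IsMulCommutative ↥T₁] [IsMulCommutative ↥T₂] in
/-- **`dχ²_x (θ H) = dχ¹_x (H)`** for every weight `x ∈ X` and `H ∈ Lie(T₁)`. [cite: SpringerLAG1998, 4.4.13] -/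
theorem dChar_theta (H : ↥(lieAlgebraGL T₁)) (x : X) :
    dChar (Additive.toMul (eX₂.symm x)) ((theta eX₁ eX₂ hT₁ hT₂ H : ↥(lieAlgebraGL T₂)) : Matrix n₂ n₂ k) =
      dChar (Additive.toMul (eX₁.symm x)) (H : Matrix n₁ n₁ k) := by
  have h := DFunLike.congr_fun (lieTorusDual_theta eX₁ eX₂ hT₁ hT₂ H) (eX₂.symm x)
  refine h.trans ?_
  change dChar (Additive.toMul ((eX₂.trans eX₁.symm) (eX₂.symm x))) (H : Matrix n₁ n₁ k) = _
  rw [AddEquiv.trans_apply, AddEquiv.apply_symm_apply]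

variable {hT₁ hT₂}

/-- **`θ (h¹_i) = h²_i`**: the coroot vectors correspond (both have `dχ_x (h_i) = ⟨x, α_i^∨⟩`,
`tangentDeriv_rootH`). [cite: Humphreys1972, 14.2] -/
theorem theta_rootH
    (h₁ : IsRootDatumOf G₁ T₁ P eX₁ eY₁) (h₂ : IsRootDatumOf G₂ T₂ P eX₂ eY₂) (i : ι) :
    theta eX₁ eX₂ hT₁ hT₂ ⟨h₁.rootH i, h₁.rootH_mem_lieAlgebraGL i⟩ =
      ⟨h₂.rootH i, h₂.rootH_mem_lieAlgebraGL i⟩ := by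
  haveI : Infinite k := IsAlgClosed.instInfinite
  apply (lieTorusDual_bijective hT₂).1
  refine AddMonoidHom.ext fun a => ?_
  rw [lieTorusDual_apply, lieTorusDual_apply]
  -- write `a = eX₂⁻¹ x`
  obtain ⟨x, rfl⟩ : ∃ x : X, eX₂.symm x = a := ⟨eX₂ a, eX₂.symm_apply_apply a⟩
  have e1 := dChar_theta eX₁ eX₂ hT₁ hT₂ ⟨h₁.rootH i, h₁.rootH_mem_lieAlgebraGL i⟩ x
  refine e1.trans ?_
  -- both equal `⟨x, α_i^∨⟩`
  have k1 : dChar (Additive.toMul (eX₁.symm x)) (h₁.rootH i) = P.toLinearMap x (P.coroot i) :=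
    h₁.tangentDeriv_rootH i x (dChar_choose_spec (Additive.toMul (eX₁.symm x)))
  have k2 : dChar (Additive.toMul (eX₂.symm x)) (h₂.rootH i) = P.toLinearMap x (P.coroot i) :=
    h₂.tangentDeriv_rootH i x (dChar_choose_spec (Additive.toMul (eX₂.symm x)))
  exact k1.trans k2.symm

end Theta

/-! ### The isomorphism of tori and the automorphisms `σ_t = (Ad t, Ad (f t))` -/

section Sigma

omit [Fintype n₁] [DecidableEq n₁] [IsMulCommutative ↥T₁] [IsMulCommutative ↥T₂] in
/-- Conjugation by a unit respects commutators. [folklore] -/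
lemma conj_commutator {n₁ : Type*} [Fintype n₁] [DecidableEq n₁] (g : GL n₁ k) (A B : Matrix n₁ n₁ k) :
    (g : Matrix n₁ n₁ k) * (A * B - B * A) * ((g⁻¹ : GL n₁ k) : Matrix n₁ n₁ k) =
      (g : Matrix n₁ n₁ k) * A * ((g⁻¹ : GL n₁ k) : Matrix n₁ n₁ k) *
          ((g : Matrix n₁ n₁ k) * B * ((g⁻¹ : GL n₁ k) : Matrix n₁ n₁ k)) -
        (g : Matrix n₁ n₁ k) * B * ((g⁻¹ : GL n₁ k) : Matrix n₁ n₁ k) *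
          ((g : Matrix n₁ n₁ k) * A * ((g⁻¹ : GL n₁ k) : Matrix n₁ n₁ k)) := by
  have hg : ((g⁻¹ : GL n₁ k) : Matrix n₁ n₁ k) * (g : Matrix n₁ n₁ k) = 1 := by
    rw [← Units.val_mul, inv_mul_cancel, Units.val_one]
  have e : ∀ C C' : Matrix n₁ n₁ k, (g : Matrix n₁ n₁ k) * C * ((g⁻¹ : GL n₁ k) : Matrix n₁ n₁ k) *
      ((g : Matrix n₁ n₁ k) * C' * ((g⁻¹ : GL n₁ k) : Matrix n₁ n₁ k)) =
      (g : Matrix n₁ n₁ k) * (C * C') * ((g⁻¹ : GL n₁ k) : Matrix n₁ n₁ k) := by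
    intro C C'
    calc (g : Matrix n₁ n₁ k) * C * ((g⁻¹ : GL n₁ k) : Matrix n₁ n₁ k) *
          ((g : Matrix n₁ n₁ k) * C' * ((g⁻¹ : GL n₁ k) : Matrix n₁ n₁ k))
        = (g : Matrix n₁ n₁ k) * C * (((g⁻¹ : GL n₁ k) : Matrix n₁ n₁ k) * (g : Matrix n₁ n₁ k)) * C' *
            ((g⁻¹ : GL n₁ k) : Matrix n₁ n₁ k) := by noncomm_ring
      _ = (g : Matrix n₁ n₁ k) * (C * C') * ((g⁻¹ : GL n₁ k) : Matrix n₁ n₁ k) := by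
          rw [hg]; noncomm_ring
  rw [e, e, ← sub_mul, ← mul_sub]

variable [IsAlgClosed k] (hT₁ : IsTorusSubgroup T₁) (hT₂ : IsTorusSubgroup T₂)

variable (eX₁ eX₂) in
/-- The isomorphism of tori `f : T₁ ≅ T₂` with `χ²_x (f t) = χ¹_x (t)` (`torusIsoOfWeights` of
`TorusIsoOfCharacters.lean`, Springer 3.2.10 (3), 9.6.1–9.6.2). [cite: SpringerLAG1998, 9.6.1–9.6.2] -/
def torusIso : ↥T₁ ≃* ↥T₂ := torusIsoOfWeights eX₁ eX₂ hT₁ hT₂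

/-- `χ²_x (f t) = χ¹_x (t)`. [folklore] -/
lemma charOfWeight_torusIso (x : X) (t : ↥T₁) :
    charOfWeight eX₂ x (torusIso eX₁ eX₂ hT₁ hT₂ t) = charOfWeight eX₁ x t :=
  charOfWeight_torusIsoOfWeights eX₁ eX₂ hT₁ hT₂ x t

variable (eX₁ eX₂) in
/-- **The Lie automorphism `σ_t = (Ad t, Ad (f t))` of `𝕃`** (`t ∈ T₁`). [folklore] -/
def sigma (t : ↥T₁) : (Matrix n₁ n₁ k × Matrix n₂ n₂ k) →ₗ⁅k⁆ (Matrix n₁ n₁ k × Matrix n₂ n₂ k) where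
  toLinearMap := (adGL ((t : ↥T₁) : GL n₁ k)).prodMap
    (adGL (((torusIso eX₁ eX₂ hT₁ hT₂ t : ↥T₂) : GL n₂ k)))
  map_lie' := by
    intro A B
    change (adGL _).prodMap (adGL _) ⁅A, B⁆ = ⁅(adGL _).prodMap (adGL _) A, (adGL _).prodMap (adGL _) B⁆
    rw [LinearMap.prodMap_apply, LinearMap.prodMap_apply, LinearMap.prodMap_apply, bracket_eq,
      bracket_eq, adGL_apply, adGL_apply, adGL_apply, adGL_apply, adGL_apply, adGL_apply]
    exact Prod.ext (conj_commutator _ _ _) (conj_commutator _ _ _)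

/-- Unfolding of `sigma`. [folklore] -/
lemma sigma_apply (t : ↥T₁) (A : Matrix n₁ n₁ k × Matrix n₂ n₂ k) :
    sigma eX₁ eX₂ hT₁ hT₂ t A =
      (((t : ↥T₁) : GL n₁ k) * A.1 * ((((t : ↥T₁) : GL n₁ k))⁻¹ : GL n₁ k),
        (((torusIso eX₁ eX₂ hT₁ hT₂ t : ↥T₂) : GL n₂ k) : Matrix n₂ n₂ k) * A.2 *
          (((((torusIso eX₁ eX₂ hT₁ hT₂ t : ↥T₂) : GL n₂ k))⁻¹ : GL n₂ k) : Matrix n₂ n₂ k)) := by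
  change (adGL _).prodMap (adGL _) A = _
  rw [LinearMap.prodMap_apply, adGL_apply, adGL_apply]

/-- **`σ_t` acts on `PW x` by the scalar `χ¹_x (t)`.** [folklore] -/
theorem sigma_apply_of_mem_PW (t : ↥T₁) {x : X} {A : Matrix n₁ n₁ k × Matrix n₂ n₂ k}
    (hA : A ∈ PW G₁ G₂ eX₁ eX₂ x) :
    sigma eX₁ eX₂ hT₁ hT₂ t A = ((charOfWeight eX₁ x t : kˣ) : k) • A := by
  rw [mem_PW_iff] at hA
  rw [sigma_apply]
  have h1 := hA.1.2 t
  have h2 := hA.2.2 (torusIso eX₁ eX₂ hT₁ hT₂ t)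
  rw [← Matrix.coe_units_inv] at h1 h2
  rw [charOfWeight_torusIso] at h2
  ext1
  · simpa using h1
  · simpa using h2

end Sigma

/-! ### The graph subalgebra `D` -/

section Graph

variable [IsAlgClosed k]
variable (hG₁ : IsConnectedReductive G₁) (hT₁ : IsMaximalTorusIn T₁ G₁)
  (hG₂ : IsConnectedReductive G₂) (hT₂ : IsMaximalTorusIn T₂ G₂)
  (h₁ : IsRootDatumOf G₁ T₁ P eX₁ eY₁) (h₂ : IsRootDatumOf G₂ T₂ P eX₂ eY₂)

/-- **Humphreys' generating set**: the pairs `(e¹_i, e²_i)`, `(f¹_i, f²_i)` for the simple roots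
`α_i` (relative to the coweight `y`), and the graph of `θ : Lie(T₁) ≅ Lie(T₂)`.
[cite: Humphreys1972, 14.2] -/
def genSet (y : Y) : Set (Matrix n₁ n₁ k × Matrix n₂ n₂ k) :=
  ((fun i => (h₁.rootE i, h₂.rootE i)) '' simpleRoots P y ∪
      (fun i => (h₁.rootF i, h₂.rootF i)) '' simpleRoots P y) ∪
    Set.range fun H : ↥(lieAlgebraGL T₁) =>
      ((H : Matrix n₁ n₁ k), ((theta eX₁ eX₂ hT₁.2.1 hT₂.2.1 H : ↥(lieAlgebraGL T₂)) : Matrix n₂ n₂ k))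

/-- **The graph subalgebra `D`**: the Lie subalgebra of `𝕃 = 𝔤𝔩_{n₁} × 𝔤𝔩_{n₂}` generated by
`genSet` (Humphreys 14.2: "let `D` be the subalgebra generated by the `x̄_α, ȳ_α, h̄_α`").
[cite: Humphreys1972, 14.2] -/
def graphSubalgebra (y : Y) : LieSubalgebra k (Matrix n₁ n₁ k × Matrix n₂ n₂ k) :=
  LieSubalgebra.lieSpan k _ (genSet hT₁ hT₂ h₁ h₂ y)

variable {hT₁ hT₂ h₁ h₂}

/-- The pairs of simple root vectors are in `D`. [folklore] -/
lemma rootE_pair_mem {y : Y} {i : ι} (hi : i ∈ simpleRoots P y) :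
    (h₁.rootE i, h₂.rootE i) ∈ graphSubalgebra hT₁ hT₂ h₁ h₂ y :=
  LieSubalgebra.subset_lieSpan (Or.inl (Or.inl ⟨i, hi, rfl⟩))

/-- The pairs of negative simple root vectors are in `D`. [folklore] -/
lemma rootF_pair_mem {y : Y} {i : ι} (hi : i ∈ simpleRoots P y) :
    (h₁.rootF i, h₂.rootF i) ∈ graphSubalgebra hT₁ hT₂ h₁ h₂ y :=
  LieSubalgebra.subset_lieSpan (Or.inl (Or.inr ⟨i, hi, rfl⟩))

/-- The graph of `θ` is in `D`. [folklore] -/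
lemma graph_mem (y : Y) (H : ↥(lieAlgebraGL T₁)) :
    ((H : Matrix n₁ n₁ k), ((theta eX₁ eX₂ hT₁.2.1 hT₂.2.1 H : ↥(lieAlgebraGL T₂)) : Matrix n₂ n₂ k)) ∈
      graphSubalgebra hT₁ hT₂ h₁ h₂ y :=
  LieSubalgebra.subset_lieSpan (Or.inr ⟨H, rfl⟩)

/-- **`(h¹_i, h²_i) ∈ D`** for every root (it is `(h¹_i, θ h¹_i)`). [cite: Humphreys1972, 14.2] -/
theorem rootH_pair_mem (y : Y) (i : ι) :
    (h₁.rootH i, h₂.rootH i) ∈ graphSubalgebra hT₁ hT₂ h₁ h₂ y := by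
  have h := graph_mem (hT₁ := hT₁) (hT₂ := hT₂) (h₁ := h₁) (h₂ := h₂) y
    ⟨h₁.rootH i, h₁.rootH_mem_lieAlgebraGL i⟩
  rwa [theta_rootH h₁ h₂ i] at h

/-- The product `𝔤₁ × 𝔤₂` as a Lie subalgebra of `𝕃`. [folklore] -/
def prodSubalgebra (G₁ : Subgroup (GL n₁ k)) (G₂ : Subgroup (GL n₂ k)) :
    LieSubalgebra k (Matrix n₁ n₁ k × Matrix n₂ n₂ k) where
  __ := (lieAlgebraGL G₁).prod (lieAlgebraGL G₂)
  lie_mem' := by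
    intro A B hA hB
    rw [Submodule.mem_carrier, SetLike.mem_coe, Submodule.mem_prod] at hA hB
    change ⁅A, B⁆ ∈ (lieAlgebraGL G₁).prod (lieAlgebraGL G₂)
    rw [Submodule.mem_prod, bracket_eq]
    exact ⟨lie_mem_lieAlgebraGL hA.1 hB.1, lie_mem_lieAlgebraGL hA.2 hB.2⟩

omit [IsAlgClosed k] in
/-- Membership in `prodSubalgebra`. [folklore] -/
lemma mem_prodSubalgebra_iff {A : Matrix n₁ n₁ k × Matrix n₂ n₂ k} :
    A ∈ prodSubalgebra G₁ G₂ ↔ A.1 ∈ lieAlgebraGL G₁ ∧ A.2 ∈ lieAlgebraGL G₂ :=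
  Submodule.mem_prod

/-- **`D ⊆ 𝔤₁ × 𝔤₂`.** [cite: Humphreys1972, 14.2] -/
theorem graphSubalgebra_le_prod (y : Y) : graphSubalgebra hT₁ hT₂ h₁ h₂ y ≤ prodSubalgebra G₁ G₂ := by
  haveI : Infinite k := IsAlgClosed.instInfinite
  rw [graphSubalgebra, LieSubalgebra.lieSpan_le]
  rintro A ((⟨i, -, rfl⟩ | ⟨i, -, rfl⟩) | ⟨H, rfl⟩)
  · exact (mem_prodSubalgebra_iff).2 ⟨(h₁.rootE_mem i).1, (h₂.rootE_mem i).1⟩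
  · exact (mem_prodSubalgebra_iff).2 ⟨(h₁.rootF_mem i).1, (h₂.rootF_mem i).1⟩
  · exact (mem_prodSubalgebra_iff).2 ⟨lieAlgebraGL_mono hT₁.1 H.2, lieAlgebraGL_mono hT₂.1 (theta _ _ _ _ H).2⟩

/-- Elements of `D` have components in `𝔤₁`, `𝔤₂`. [folklore] -/
lemma mem_lieAlgebraGL_of_mem {y : Y} {A : Matrix n₁ n₁ k × Matrix n₂ n₂ k}
    (hA : A ∈ graphSubalgebra hT₁ hT₂ h₁ h₂ y) : A.1 ∈ lieAlgebraGL G₁ ∧ A.2 ∈ lieAlgebraGL G₂ :=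
  mem_prodSubalgebra_iff.1 (graphSubalgebra_le_prod y hA)

/-- **`D` is stable under `σ_t = (Ad t, Ad (f t))`** (each generator is an eigenvector).
[cite: Humphreys1972, 14.2] -/
theorem sigma_mem_graphSubalgebra (y : Y) (t : ↥T₁) {A : Matrix n₁ n₁ k × Matrix n₂ n₂ k}
    (hA : A ∈ graphSubalgebra hT₁ hT₂ h₁ h₂ y) :
    sigma eX₁ eX₂ hT₁.2.1 hT₂.2.1 t A ∈ graphSubalgebra hT₁ hT₂ h₁ h₂ y := by
  haveI : Infinite k := IsAlgClosed.instInfinite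
  suffices hle : graphSubalgebra hT₁ hT₂ h₁ h₂ y ≤
      (graphSubalgebra hT₁ hT₂ h₁ h₂ y).comap (sigma eX₁ eX₂ hT₁.2.1 hT₂.2.1 t) from hle hA
  rw [graphSubalgebra, LieSubalgebra.lieSpan_le]
  intro s hs
  rw [SetLike.mem_coe, LieSubalgebra.mem_comap]
  have hsD : s ∈ LieSubalgebra.lieSpan k _ (genSet hT₁ hT₂ h₁ h₂ y) := LieSubalgebra.subset_lieSpan hs
  -- each generator lies in some `PW x`, on which `σ_t` is a scalar
  obtain ⟨x, hx⟩ : ∃ x : X, s ∈ PW G₁ G₂ eX₁ eX₂ x := by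
    rcases hs with ((⟨i, -, rfl⟩ | ⟨i, -, rfl⟩) | ⟨H, rfl⟩)
    · exact ⟨P.root i, mem_PW_iff.2 ⟨h₁.rootE_mem i, h₂.rootE_mem i⟩⟩
    · exact ⟨-P.root i, mem_PW_iff.2 ⟨h₁.rootF_mem' i, h₂.rootF_mem' i⟩⟩
    · exact ⟨0, mem_PW_zero_of_mem_lieAlgebraGL hT₁.1 hT₂.1 H.2 (theta _ _ _ _ H).2⟩
  rw [sigma_apply_of_mem_PW _ _ t hx]
  exact (LieSubalgebra.lieSpan k _ _).smul_mem _ hsD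

omit [IsMulCommutative ↥T₁] [IsMulCommutative ↥T₂] in
/-- **`[(H, θH), A] = dχ¹_x(H) A` for `A ∈ PW x`** (the graph of `θ` acts diagonally on the product
weight spaces, with the same scalar on both components). [cite: Humphreys1972, 14.2] -/
theorem lie_graph_of_mem_PW (H : ↥(lieAlgebraGL T₁)) {x : X} {A : Matrix n₁ n₁ k × Matrix n₂ n₂ k}
    (hA : A ∈ PW G₁ G₂ eX₁ eX₂ x) :
    ⁅(((H : Matrix n₁ n₁ k), ((theta eX₁ eX₂ hT₁.2.1 hT₂.2.1 H : ↥(lieAlgebraGL T₂)) : Matrix n₂ n₂ k)) :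
        Matrix n₁ n₁ k × Matrix n₂ n₂ k), A⁆ =
      dChar (Additive.toMul (eX₁.symm x)) (H : Matrix n₁ n₁ k) • A := by
  rw [mem_PW_iff] at hA
  rw [bracket_eq]
  have e1 := lie_eq_dChar_smul (Additive.toMul (eX₁.symm x)) hA.1.2 H.2
  have e2 := lie_eq_dChar_smul (Additive.toMul (eX₂.symm x)) hA.2.2 (theta eX₁ eX₂ hT₁.2.1 hT₂.2.1 H).2
  rw [dChar_theta eX₁ eX₂] at e2
  ext1
  · exact e1
  · exact e2

/-- `[(h¹_i, h²_i), A] = ⟨x, α_i^∨⟩ A` for `A ∈ PW x`. [cite: Humphreys1972, 8.4] -/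
theorem lie_rootH_pair_of_mem_PW (i : ι) {x : X} {A : Matrix n₁ n₁ k × Matrix n₂ n₂ k}
    (hA : A ∈ PW G₁ G₂ eX₁ eX₂ x) :
    ⁅((h₁.rootH i, h₂.rootH i) : Matrix n₁ n₁ k × Matrix n₂ n₂ k), A⁆ =
      ((P.toLinearMap x (P.coroot i) : ℤ) : k) • A := by
  haveI : Infinite k := IsAlgClosed.instInfinite
  rw [mem_PW_iff] at hA
  rw [bracket_eq]
  ext1
  · exact h₁.lie_rootH_of_mem_weightSpaceGL i x hA.1.2
  · exact h₂.lie_rootH_of_mem_weightSpaceGL i x hA.2.2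

/-! ### The projections of `D` -/

/-- The second projection of `D`, a bracket-closed subspace of `𝔤𝔩_{n₂}`. [folklore] -/
def sndSubmodule (y : Y) : Submodule k (Matrix n₂ n₂ k) :=
  ((graphSubalgebra hT₁ hT₂ h₁ h₂ y).map (LieHom.snd k _ _)).toSubmodule

/-- Membership in `sndSubmodule`. [folklore] -/
lemma mem_sndSubmodule_iff {y : Y} {B : Matrix n₂ n₂ k} :
    B ∈ sndSubmodule (hT₁ := hT₁) (hT₂ := hT₂) (h₁ := h₁) (h₂ := h₂) y ↔
      ∃ A ∈ graphSubalgebra hT₁ hT₂ h₁ h₂ y, A.2 = B := by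
  rw [sndSubmodule, LieSubalgebra.mem_toSubmodule, LieSubalgebra.mem_map]
  simp

/-- `sndSubmodule` is closed under the commutator. [folklore] -/
lemma sndSubmodule_lie_mem {y : Y} {A B : Matrix n₂ n₂ k}
    (hA : A ∈ sndSubmodule (hT₁ := hT₁) (hT₂ := hT₂) (h₁ := h₁) (h₂ := h₂) y)
    (hB : B ∈ sndSubmodule (hT₁ := hT₁) (hT₂ := hT₂) (h₁ := h₁) (h₂ := h₂) y) :
    A * B - B * A ∈ sndSubmodule (hT₁ := hT₁) (hT₂ := hT₂) (h₁ := h₁) (h₂ := h₂) y := by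
  have := ((graphSubalgebra hT₁ hT₂ h₁ h₂ y).map (LieHom.snd k _ _)).lie_mem hA hB
  rwa [Ring.lie_def] at this

/-- The first projection of `D`. [folklore] -/
def fstSubmodule (y : Y) : Submodule k (Matrix n₁ n₁ k) :=
  ((graphSubalgebra hT₁ hT₂ h₁ h₂ y).map (LieHom.fst k _ _)).toSubmodule

/-- Membership in `fstSubmodule`. [folklore] -/
lemma mem_fstSubmodule_iff {y : Y} {B : Matrix n₁ n₁ k} :
    B ∈ fstSubmodule (hT₁ := hT₁) (hT₂ := hT₂) (h₁ := h₁) (h₂ := h₂) y ↔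
      ∃ A ∈ graphSubalgebra hT₁ hT₂ h₁ h₂ y, A.1 = B := by
  rw [fstSubmodule, LieSubalgebra.mem_toSubmodule, LieSubalgebra.mem_map]
  simp

/-- `fstSubmodule` is closed under the commutator. [folklore] -/
lemma fstSubmodule_lie_mem {y : Y} {A B : Matrix n₁ n₁ k}
    (hA : A ∈ fstSubmodule (hT₁ := hT₁) (hT₂ := hT₂) (h₁ := h₁) (h₂ := h₂) y)
    (hB : B ∈ fstSubmodule (hT₁ := hT₁) (hT₂ := hT₂) (h₁ := h₁) (h₂ := h₂) y) :
    A * B - B * A ∈ fstSubmodule (hT₁ := hT₁) (hT₂ := hT₂) (h₁ := h₁) (h₂ := h₂) y := by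
  have := ((graphSubalgebra hT₁ hT₂ h₁ h₂ y).map (LieHom.fst k _ _)).lie_mem hA hB
  rwa [Ring.lie_def] at this

include hG₂ hT₂ in
/-- **`p₂(D)` contains all root vectors `e²_γ`** (the generation theorem of `RootStrings.lean`
applied to the bracket-closed `p₂(D) ∋ e²_i, f²_i`, `i` simple). [cite: Humphreys1972, 14.2] -/
theorem exists_mem_snd_eq_rootE [CharZero k] [Finite ι] {y : Y} (hy : ∀ i, P.root' i y ≠ 0) (γ : ι) :
    ∃ A ∈ graphSubalgebra hT₁ hT₂ h₁ h₂ y, A.2 = h₂.rootE γ := by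
  rw [← mem_sndSubmodule_iff]
  refine h₂.rootE_mem_of_forall_simpleRoots hG₂ hT₂ hy (fun A hA B hB => sndSubmodule_lie_mem hA hB)
    (fun i hi => ?_) (fun i hi => ?_) γ
  · exact mem_sndSubmodule_iff.2 ⟨_, rootE_pair_mem hi, rfl⟩
  · exact mem_sndSubmodule_iff.2 ⟨_, rootF_pair_mem hi, rfl⟩

include hG₂ hT₂ in
/-- `p₂(D)` contains all `f²_γ`. [cite: Humphreys1972, 14.2] -/
theorem exists_mem_snd_eq_rootF [CharZero k] [Finite ι] {y : Y} (hy : ∀ i, P.root' i y ≠ 0) (γ : ι) :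
    ∃ A ∈ graphSubalgebra hT₁ hT₂ h₁ h₂ y, A.2 = h₂.rootF γ := by
  rw [← mem_sndSubmodule_iff]
  refine (h₂.rootF_rootH_mem_of_forall_simpleRoots hG₂ hT₂ hy (fun A hA B hB => sndSubmodule_lie_mem hA hB)
    (fun i hi => ?_) (fun i hi => ?_) γ).1
  · exact mem_sndSubmodule_iff.2 ⟨_, rootE_pair_mem hi, rfl⟩
  · exact mem_sndSubmodule_iff.2 ⟨_, rootF_pair_mem hi, rfl⟩

include hG₁ hT₁ in
/-- `p₁(D)` contains all `e¹_γ`. [cite: Humphreys1972, 14.2] -/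
theorem exists_mem_fst_eq_rootE [CharZero k] [Finite ι] {y : Y} (hy : ∀ i, P.root' i y ≠ 0) (γ : ι) :
    ∃ A ∈ graphSubalgebra hT₁ hT₂ h₁ h₂ y, A.1 = h₁.rootE γ := by
  rw [← mem_fstSubmodule_iff]
  refine h₁.rootE_mem_of_forall_simpleRoots hG₁ hT₁ hy (fun A hA B hB => fstSubmodule_lie_mem hA hB)
    (fun i hi => ?_) (fun i hi => ?_) γ
  · exact mem_fstSubmodule_iff.2 ⟨_, rootE_pair_mem hi, rfl⟩
  · exact mem_fstSubmodule_iff.2 ⟨_, rootF_pair_mem hi, rfl⟩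

include hG₁ hT₁ in
/-- `p₁(D)` contains all `f¹_γ`. [cite: Humphreys1972, 14.2] -/
theorem exists_mem_fst_eq_rootF [CharZero k] [Finite ι] {y : Y} (hy : ∀ i, P.root' i y ≠ 0) (γ : ι) :
    ∃ A ∈ graphSubalgebra hT₁ hT₂ h₁ h₂ y, A.1 = h₁.rootF γ := by
  rw [← mem_fstSubmodule_iff]
  refine (h₁.rootF_rootH_mem_of_forall_simpleRoots hG₁ hT₁ hy (fun A hA B hB => fstSubmodule_lie_mem hA hB)
    (fun i hi => ?_) (fun i hi => ?_) γ).1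
  · exact mem_fstSubmodule_iff.2 ⟨_, rootE_pair_mem hi, rfl⟩
  · exact mem_fstSubmodule_iff.2 ⟨_, rootF_pair_mem hi, rfl⟩

/-- **`p₂(D) ⊇ Lie(T₂)`** (`θ` is surjective). [folklore] -/
theorem exists_mem_snd_eq_of_mem_lieAlgebraGL (y : Y) {H₂ : Matrix n₂ n₂ k} (hH₂ : H₂ ∈ lieAlgebraGL T₂) :
    ∃ A ∈ graphSubalgebra hT₁ hT₂ h₁ h₂ y, A.2 = H₂ := by
  set H := (theta eX₁ eX₂ hT₁.2.1 hT₂.2.1).symm ⟨H₂, hH₂⟩ with hH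
  refine ⟨_, graph_mem y H, ?_⟩
  change ((theta eX₁ eX₂ hT₁.2.1 hT₂.2.1 H : ↥(lieAlgebraGL T₂)) : Matrix n₂ n₂ k) = H₂
  rw [hH, LinearEquiv.apply_symm_apply]

/-- `p₁(D) ⊇ Lie(T₁)`. [folklore] -/
theorem exists_mem_fst_eq_of_mem_lieAlgebraGL (y : Y) {H₁ : Matrix n₁ n₁ k} (hH₁ : H₁ ∈ lieAlgebraGL T₁) :
    ∃ A ∈ graphSubalgebra hT₁ hT₂ h₁ h₂ y, A.1 = H₁ :=
  ⟨_, graph_mem y ⟨H₁, hH₁⟩, rfl⟩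

end Graph

end LieGraph

end Literature.NumberTheory.Automorphic
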